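import Mathlib
import Summits.ValiantsHypothesis.ValiantsHypothesis.Theorems.DivisionGapTriangularDimersDivisionEasyDefs

/-!
# Crux `DivisionGap.TriangularDimersDivisionEasy` (stmt-ValiantsHypothesis-5067), line `diagonal-spider-shuffling` —
registered stub `stub_gadgetReplacement`

GADGET REPLACEMENT (the engine of every positive local move of the line): two gadgets `X` (private
vertices `C₁`) and `Y` (private vertices `C₂`) on the same attachment set `A` whose boundary signatures are
proportional, `gsig X S = Λ * gsig Y S` for every `S ⊆ A`, give proportional matching sums once glued
through the attachments into any ambient graph (`U`, weights `Wuu`, `Wua`, `Wau`):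
`ihaf (glue Wuu Wua Wau X) = Λ * ihaf (glue Wuu Wua Wau Y)`.  This is the sign-free core of urban
renewal / graphical condensation (Propp 2003 §2; Kuo 2004 Thm 2.1).

Proof (cut at the attachments).  For a fixed-point-free involution `f` of `U ⊕ (A ⊕ C)` let
`S(f) ⊆ A` be the set of attachments matched INTO the gadget.  Fibrewise in `S`, the matchings with
`S(f) = S` and non-zero weight are exactly the involutions preserving the cut
`(U ⊔ (A ∖ S)) ⊔ (S ⊔ C)` with no `(A∖S)–(A∖S)` pair, and their weight splits as an outer weight (ambient
edges only) times an inner weight (gadget edges only); involutions preserving a cut are pairs of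
involutions of the two sides (`Gadget.sum_invol_cut`).  Hence
`ihaf (glue Wuu Wua Wau X) = ∑_S Outer S * gsig X S` with `Outer S` independent of the gadget
(`Gadget.ihaf_glue_eq_sum`), and the claim follows by linearity.  Everything is over an arbitrary
commutative semiring (no subtraction).
-/

-- `Summit.ValiantsHypothesis.ValiantsHypothesis.…` is the tree's mandated single-conjunct layout (Sub = Summit).
set_option linter.dupNamespace false

namespace Summit.ValiantsHypothesis.ValiantsHypothesis.Theorems.TriangularDimersDivisionEasy.Shuffling

open scoped BigOperators
open Finset Sum

noncomputable section

namespace Gadget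
/-! ### Helper lemmas for `stub_gadgetReplacement` (this stub's private namespace) -/

variable {R : Type} [CommSemiring R]

/-- CUT LEMMA on a literal sum type: fixed-point-free involutions of `P ⊕ Q` mapping each summand to
itself are the maps `Sum.map g h` for pairs of fixed-point-free involutions `g` of `P` and `h` of `Q`, and the
weight is multiplicative; so the restricted matching sum factors as `ihaf · * ihaf ·`. [folklore] -/
theorem sum_invol_sumType {P Q : Type} [Fintype P] [DecidableEq P] [Fintype Q] [DecidableEq Q]
    (M : P ⊕ Q → P ⊕ Q → R) :
    ∑ f ∈ ((univ : Finset (P ⊕ Q → P ⊕ Q)).filter (fun f => ∀ v, f (f v) = v ∧ f v ≠ v)).filter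
        (fun f => ∀ v, (f v).isLeft = v.isLeft), ∏ v, M v (f v) =
      ihaf (fun p p' => M (inl p) (inl p')) * ihaf (fun q q' => M (inr q) (inr q')) := by
  unfold ihaf
  rw [Finset.sum_mul_sum, ← Finset.sum_product']
  symm
  refine Finset.sum_nbij' (fun gh => Sum.map gh.1 gh.2)
    (fun f => (fun p => Sum.elim id (fun _ => p) (f (inl p)),
      fun q => Sum.elim (fun _ => q) id (f (inr q)))) ?_ ?_ ?_ ?_ ?_
  · rintro ⟨g, h⟩ hgh
    simp only [Finset.mem_product, Finset.mem_filter, Finset.mem_univ, true_and] at hgh ⊢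
    refine ⟨?_, fun v => Sum.isLeft_map _ _ _⟩
    rintro (p | q)
    · simp only [Sum.map_inl, Sum.inl.injEq, ne_eq]; exact hgh.1 p
    · simp only [Sum.map_inr, Sum.inr.injEq, ne_eq]; exact hgh.2 q
  · rintro f hf
    simp only [Finset.mem_product, Finset.mem_filter, Finset.mem_univ, true_and] at hf ⊢
    obtain ⟨hf, hst⟩ := hf
    constructor
    · intro p
      obtain ⟨p', hp'⟩ := Sum.isLeft_iff.mp ((hst (inl p)).trans Sum.isLeft_inl)
      have h2 : f (inl p') = inl p := by rw [← hp', (hf _).1]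
      refine ⟨by simp only [hp', Sum.elim_inl, id, h2], fun h => (hf (inl p)).2 ?_⟩
      simp only [hp', Sum.elim_inl, id] at h
      rw [hp', h]
    · intro q
      obtain ⟨q', hq'⟩ := Sum.isRight_iff.mp
        (Sum.isLeft_eq_false.mp ((hst (inr q)).trans Sum.isLeft_inr))
      have h2 : f (inr q') = inr q := by rw [← hq', (hf _).1]
      refine ⟨by simp only [hq', Sum.elim_inr, id, h2], fun h => (hf (inr q)).2 ?_⟩
      simp only [hq', Sum.elim_inr, id] at h
      rw [hq', h]
  · rintro ⟨g, h⟩ _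
    simp only [Sum.map_inl, Sum.map_inr, Sum.elim_inl, Sum.elim_inr, id]
  · rintro f hf
    simp only [Finset.mem_filter, Finset.mem_univ, true_and] at hf
    obtain ⟨-, hst⟩ := hf
    funext v
    rcases v with p | q
    · obtain ⟨p', hp'⟩ := Sum.isLeft_iff.mp ((hst (inl p)).trans Sum.isLeft_inl)
      simp only [Sum.map_inl, hp', Sum.elim_inl, id]
    · obtain ⟨q', hq'⟩ := Sum.isRight_iff.mp
        (Sum.isLeft_eq_false.mp ((hst (inr q)).trans Sum.isLeft_inr))
      simp only [Sum.map_inr, hq', Sum.elim_inr, id]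
  · rintro ⟨g, h⟩ _
    simp only [Fintype.prod_sum_type, Sum.map_inl, Sum.map_inr]

/-- CUT LEMMA transported along `e : P ⊕ Q ≃ V`: the matching sum of `V`, restricted to the
fixed-point-free involutions preserving the two sides of the cut, with weights read off a block weight
`M` on `P ⊕ Q`, is `ihaf` (diagonal block on `P`) times `ihaf` (diagonal block on `Q`). [folklore] -/
theorem sum_invol_cut {V P Q : Type} [Fintype V] [DecidableEq V] [Fintype P] [DecidableEq P]
    [Fintype Q] [DecidableEq Q] (e : P ⊕ Q ≃ V) (M : P ⊕ Q → P ⊕ Q → R) :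
    ∑ f ∈ ((univ : Finset (V → V)).filter (fun f => ∀ v, f (f v) = v ∧ f v ≠ v)).filter
        (fun f => ∀ v, (e.symm (f v)).isLeft = (e.symm v).isLeft),
        ∏ v, M (e.symm v) (e.symm (f v)) =
      ihaf (fun p p' => M (inl p) (inl p')) * ihaf (fun q q' => M (inr q) (inr q')) := by
  rw [← sum_invol_sumType M]
  symm
  refine Finset.sum_equiv (e.arrowCongr e) (fun f => ?_) (fun f _ => ?_)
  · simp only [Finset.mem_filter, Finset.mem_univ, true_and, Equiv.arrowCongr_apply,
      Function.comp_apply, Equiv.symm_apply_apply]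
    refine and_congr ⟨fun h v => ?_, fun h x => ?_⟩ ⟨fun h v => h (e.symm v), fun h x => ?_⟩
    · refine ⟨by rw [(h _).1, Equiv.apply_symm_apply], fun h' => (h (e.symm v)).2 ?_⟩
      rw [← e.symm_apply_apply (f (e.symm v)), h']
    · have h1 := h (e x)
      simp only [Equiv.symm_apply_apply] at h1
      exact ⟨e.injective h1.1, fun h' => h1.2 (by rw [h'])⟩
    · simpa only [Equiv.symm_apply_apply] using h (e x)
  · simp only [Equiv.arrowCongr_apply, Function.comp_apply, Equiv.symm_apply_apply]
    exact Fintype.prod_equiv e _ _ (fun x => by simp only [Equiv.symm_apply_apply])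

variable {U A C : Type}

/-- The gadget block of a glued weight. [folklore] -/
theorem glue_inr_inr (Wuu : U → U → R) (Wua : U → A → R) (Wau : A → U → R)
    (X : A ⊕ C → A ⊕ C → R) (p q : A ⊕ C) :
    glue Wuu Wua Wau X (inr p) (inr q) = X p q := by
  cases p <;> cases q <;> rfl

/-- FIBRE BOOKKEEPING, good case.  `ι` marks the outer side of the cut at `S` and `W'` is a weight that
agrees with the glued weight across allowed pairs; for a GOOD involution `f` in the fibre of `S` (every
private vertex and every attachment of `S` is matched into the gadget, every other attachment into `U`),
`f` preserves the cut and its glued weight is its `W'`-weight, factor by factor. [folklore] -/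
theorem stab_and_weight (Wuu : U → U → R) (Wua : U → A → R) (Wau : A → U → R)
    (X : A ⊕ C → A ⊕ C → R) (S : Finset A) (ι : U ⊕ (A ⊕ C) → Bool)
    (W' : U ⊕ (A ⊕ C) → U ⊕ (A ⊕ C) → R)
    (hι₁ : ∀ u, ι (inl u) = true) (hι₂ : ∀ a, a ∉ S → ι (inr (inl a)) = true)
    (hι₃ : ∀ a, a ∈ S → ι (inr (inl a)) = false) (hι₄ : ∀ c, ι (inr (inr c)) = false)
    (hW₁ : ∀ u u', W' (inl u) (inl u') = Wuu u u')
    (hW₂ : ∀ u a, a ∉ S → W' (inl u) (inr (inl a)) = Wua u a)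
    (hW₃ : ∀ a u, a ∉ S → W' (inr (inl a)) (inl u) = Wau a u)
    (hW₅ : ∀ p q : A ⊕ C, (∀ a, p = inl a → a ∈ S) → (∀ a, q = inl a → a ∈ S) →
      W' (inr p) (inr q) = X p q)
    (f : U ⊕ (A ⊕ C) → U ⊕ (A ⊕ C)) (hf : ∀ v, f (f v) = v ∧ f v ≠ v)
    (hS : ∀ a, a ∈ S ↔ ∃ p, f (inr (inl a)) = inr p) (hgood : ∀ c, ∃ p, f (inr (inr c)) = inr p)
    (v : U ⊕ (A ⊕ C)) :
    ι (f v) = ι v ∧ glue Wuu Wua Wau X v (f v) = W' v (f v) := by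
  -- the partner of a vertex matched into the gadget lies on the inner side of the cut
  have hT : ∀ p q : A ⊕ C, f (inr p) = inr q → ∀ a, q = inl a → a ∈ S := by
    rintro p q hpq a rfl
    exact (hS a).mpr ⟨p, by rw [← hpq, (hf _).1]⟩
  have hιT : ∀ q : A ⊕ C, (∀ a, q = inl a → a ∈ S) → ι (inr q) = false := by
    rintro (a | c) hq
    · exact hι₃ a (hq a rfl)
    · exact hι₄ c
  rcases v with u | a | c
  · -- an ambient vertex
    rcases hfu : f (inl u) with u' | a | c
    · exact ⟨by rw [hι₁, hι₁], (hW₁ u u').symm⟩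
    · have ha : a ∉ S := fun haS => by
        obtain ⟨q, hq⟩ := (hS a).mp haS
        rw [← hfu, (hf _).1] at hq
        cases hq
      exact ⟨by rw [hι₁, hι₂ a ha], (hW₂ u a ha).symm⟩
    · exfalso
      obtain ⟨q, hq⟩ := hgood c
      rw [← hfu, (hf _).1] at hq
      cases hq
  · -- an attachment
    rcases hp : f (inr (inl a)) with u | p
    · have haS : a ∉ S := fun haS => by
        obtain ⟨q, hq⟩ := (hS a).mp haS
        rw [hp] at hq
        cases hq
      exact ⟨by rw [hι₁, hι₂ a haS], (hW₃ a u haS).symm⟩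
    · have haS : a ∈ S := (hS a).mpr ⟨p, hp⟩
      have haT : ∀ a', (inl a : A ⊕ C) = inl a' → a' ∈ S := by
        rintro a' h
        cases h
        exact haS
      have hpT := hT (inl a) p hp
      rw [hι₃ a haS, hιT p hpT, glue_inr_inr, hW₅ (inl a) p haT hpT]
      exact ⟨rfl, rfl⟩
  · -- a private vertex of the gadget
    obtain ⟨p, hp⟩ := hgood c
    have hcT : ∀ a', (inr c : A ⊕ C) = inl a' → a' ∈ S := fun a' h => by cases h
    have hpT := hT (inr c) p hp
    rw [hp, hι₄, hιT p hpT, glue_inr_inr, hW₅ (inr c) p hcT hpT]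
    exact ⟨rfl, rfl⟩

/-- FIBRE BOOKKEEPING, bad case: an involution matching a private gadget vertex to an ambient vertex has
glued weight `0` (there is no such edge) and does not preserve the cut. [folklore] -/
theorem bad_case [Fintype U] [Fintype A] [Fintype C] (Wuu : U → U → R) (Wua : U → A → R)
    (Wau : A → U → R) (X : A ⊕ C → A ⊕ C → R) (ι : U ⊕ (A ⊕ C) → Bool)
    (hι₁ : ∀ u, ι (inl u) = true) (hι₄ : ∀ c, ι (inr (inr c)) = false)
    (f : U ⊕ (A ⊕ C) → U ⊕ (A ⊕ C)) (c : C) (hc : ∀ p, f (inr (inr c)) ≠ inr p) :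
    ∏ v, glue Wuu Wua Wau X v (f v) = 0 ∧ ¬ ∀ v, ι (f v) = ι v := by
  obtain ⟨u, hu⟩ : ∃ u, f (inr (inr c)) = inl u := by
    rcases h : f (inr (inr c)) with u | p
    · exact ⟨u, rfl⟩
    · exact absurd h (hc p)
  refine ⟨Finset.prod_eq_zero (Finset.mem_univ (inr (inr c))) (by rw [hu]; rfl), fun h => ?_⟩
  have h1 := h (inr (inr c))
  rw [hu, hι₁, hι₄] at h1
  cases h1

/-- FIBRE BOOKKEEPING, off-fibre case: an involution preserving the cut at `S` but NOT in the fibre of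
`S` matches two attachments outside `S` to each other, a pair on which the outer weight `W'` vanishes.
[folklore] -/
theorem offFibre_case [Fintype U] [Fintype A] [Fintype C] (S : Finset A) (ι : U ⊕ (A ⊕ C) → Bool)
    (W' : U ⊕ (A ⊕ C) → U ⊕ (A ⊕ C) → R)
    (hι₁ : ∀ u, ι (inl u) = true) (hι₂ : ∀ a, a ∉ S → ι (inr (inl a)) = true)
    (hι₃ : ∀ a, a ∈ S → ι (inr (inl a)) = false) (hι₄ : ∀ c, ι (inr (inr c)) = false)
    (hW₄ : ∀ a a', a ∉ S → a' ∉ S → W' (inr (inl a)) (inr (inl a')) = 0)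
    (f : U ⊕ (A ⊕ C) → U ⊕ (A ⊕ C)) (hstab : ∀ v, ι (f v) = ι v)
    (hS : ¬ ∀ a, (a ∈ S ↔ ∃ p, f (inr (inl a)) = inr p)) :
    ∏ v, W' v (f v) = 0 := by
  obtain ⟨a, ha⟩ := not_forall.mp hS
  apply Finset.prod_eq_zero (Finset.mem_univ (inr (inl a)))
  rcases hfa : f (inr (inl a)) with u | a' | c
  · exfalso
    refine ha ⟨fun haS => ?_, fun ⟨p, hp⟩ => by rw [hfa] at hp; cases hp⟩
    have hsa := hstab (inr (inl a))
    rw [hfa, hι₁, hι₃ a haS] at hsa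
    cases hsa
  · have haS : a ∉ S := fun haS => ha ⟨fun _ => ⟨inl a', hfa⟩, fun _ => haS⟩
    have ha'S : a' ∉ S := fun ha'S => by
      have hsa := hstab (inr (inl a))
      rw [hfa, hι₃ a' ha'S, hι₂ a haS] at hsa
      cases hsa
    exact hW₄ a a' haS ha'S
  · exfalso
    have haS : a ∉ S := fun haS => ha ⟨fun _ => ⟨inr c, hfa⟩, fun _ => haS⟩
    have hsa := hstab (inr (inl a))
    rw [hfa, hι₄, hι₂ a haS] at hsa
    cases hsa

/-- The cut at `S` as an equivalence `(U ⊕ (A ∖ S)) ⊕ (S ⊔ C) ≃ U ⊕ (A ⊕ C)` (the inner side is literally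
the vertex type of `gsig X S`). [folklore] -/
theorem exists_cutEquiv [DecidableEq A] (S : Finset A) :
    ∃ e : (U ⊕ {a : A // a ∉ S}) ⊕ {v : A ⊕ C // ∀ a : A, v = Sum.inl a → a ∈ S} ≃ U ⊕ (A ⊕ C),
      (∀ u, e (inl (inl u)) = inl u) ∧ (∀ a, e (inl (inr a)) = inr (inl a.1)) ∧
        ∀ v, e (inr v) = inr v.1 := by
  let φ : (U ⊕ {a : A // a ∉ S}) ⊕ {v : A ⊕ C // ∀ a : A, v = Sum.inl a → a ∈ S} →
      U ⊕ (A ⊕ C) :=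
    Sum.elim (Sum.elim (fun u => inl u) (fun a => inr (inl a.1))) (fun v => inr v.1)
  have hφ : Function.Bijective φ := by
    refine ⟨?_, ?_⟩
    · rintro ((u | ⟨a, ha⟩) | ⟨v, hv⟩) ((u' | ⟨a', ha'⟩) | ⟨v', hv'⟩) h
      all_goals
        simp only [φ, Sum.elim_inl, Sum.elim_inr, Sum.inl.injEq, Sum.inr.injEq, reduceCtorEq] at h
      · rw [h]
      · subst h; rfl
      · exact absurd (hv' a h.symm) ha
      · exact absurd (hv a' h) ha'
      · subst h; rfl
    · rintro (u | a | c)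
      · exact ⟨inl (inl u), rfl⟩
      · by_cases ha : a ∈ S
        · exact ⟨inr ⟨inl a, fun a' h => by cases h; exact ha⟩, rfl⟩
        · exact ⟨inl (inr ⟨a, ha⟩), rfl⟩
      · exact ⟨inr ⟨inr c, fun a h => by cases h⟩, rfl⟩
  exact ⟨Equiv.ofBijective φ hφ, fun u => rfl, fun a => rfl, fun v => rfl⟩

variable [Fintype U] [DecidableEq U] [Fintype A] [DecidableEq A] [Fintype C] [DecidableEq C]

/-- FIBRE IDENTITY along a cut equivalence `e` at `S`, for any block weight `M` on the cut type whose
outer block is the ambient weight with `(A∖S)–(A∖S)` entries zero and whose inner block is the gadget: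
the glued matching sum over the fibre of `S` is `ihaf (outer block) * ihaf (inner block)`.
[cite: Propp2003, §2] -/
theorem fibre_sum_of_block (Wuu : U → U → R) (Wua : U → A → R) (Wau : A → U → R)
    (X : A ⊕ C → A ⊕ C → R) (S : Finset A)
    (e : (U ⊕ {a : A // a ∉ S}) ⊕ {v : A ⊕ C // ∀ a : A, v = Sum.inl a → a ∈ S} ≃ U ⊕ (A ⊕ C))
    (he₁ : ∀ u, e (inl (inl u)) = inl u) (he₂ : ∀ a, e (inl (inr a)) = inr (inl a.1))
    (he₃ : ∀ v, e (inr v) = inr v.1)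
    (M : (U ⊕ {a : A // a ∉ S}) ⊕ {v : A ⊕ C // ∀ a : A, v = Sum.inl a → a ∈ S} →
      (U ⊕ {a : A // a ∉ S}) ⊕ {v : A ⊕ C // ∀ a : A, v = Sum.inl a → a ∈ S} → R)
    (hM₁ : ∀ u u', M (inl (inl u)) (inl (inl u')) = Wuu u u')
    (hM₂ : ∀ u a, M (inl (inl u)) (inl (inr a)) = Wua u a.1)
    (hM₃ : ∀ a u, M (inl (inr a)) (inl (inl u)) = Wau a.1 u)
    (hM₄ : ∀ a a', M (inl (inr a)) (inl (inr a')) = 0)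
    (hM₅ : ∀ q q', M (inr q) (inr q') = X q.1 q'.1) :
    ∑ f ∈ ((univ : Finset (U ⊕ (A ⊕ C) → U ⊕ (A ⊕ C))).filter
        (fun f => ∀ v, f (f v) = v ∧ f v ≠ v)).filter
        (fun f => (univ.filter fun a => (f (inr (inl a))).isRight) = S),
        ∏ v, glue Wuu Wua Wau X v (f v) =
      ihaf (fun p p' => M (inl p) (inl p')) * ihaf (fun q q' => M (inr q) (inr q')) := by
  -- values of `e.symm`, of the cut indicator `ι v := (e.symm v).isLeft` and of the pulled-back weight
  have hs₁ : ∀ u, e.symm (inl u) = inl (inl u) := fun u => e.symm_apply_eq.mpr (he₁ u).symm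
  have hs₂ : ∀ a (h : a ∉ S), e.symm (inr (inl a)) = inl (inr ⟨a, h⟩) := fun a h =>
    e.symm_apply_eq.mpr (he₂ ⟨a, h⟩).symm
  have hs₃ : ∀ (p : A ⊕ C) (h : ∀ a, p = inl a → a ∈ S), e.symm (inr p) = inr ⟨p, h⟩ :=
    fun p h => e.symm_apply_eq.mpr (he₃ ⟨p, h⟩).symm
  have hι₁ : ∀ u, (e.symm (inl u)).isLeft = true := fun u => by rw [hs₁]; rfl
  have hι₂ : ∀ a, a ∉ S → (e.symm (inr (inl a))).isLeft = true := fun a ha => by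
    rw [hs₂ a ha]; rfl
  have hι₃ : ∀ a, a ∈ S → (e.symm (inr (inl a))).isLeft = false := fun a ha => by
    rw [hs₃ (inl a) (fun a' h => by cases h; exact ha)]; rfl
  have hι₄ : ∀ c, (e.symm (inr (inr c))).isLeft = false := fun c => by
    rw [hs₃ (inr c) (fun a h => by cases h)]; rfl
  have hW₁ : ∀ u u', M (e.symm (inl u)) (e.symm (inl u')) = Wuu u u' := fun u u' => by
    rw [hs₁, hs₁, hM₁]
  have hW₂ : ∀ u a, a ∉ S → M (e.symm (inl u)) (e.symm (inr (inl a))) = Wua u a :=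
    fun u a ha => by rw [hs₁, hs₂ a ha, hM₂]
  have hW₃ : ∀ a u, a ∉ S → M (e.symm (inr (inl a))) (e.symm (inl u)) = Wau a u :=
    fun a u ha => by rw [hs₂ a ha, hs₁, hM₃]
  have hW₄ : ∀ a a', a ∉ S → a' ∉ S → M (e.symm (inr (inl a))) (e.symm (inr (inl a'))) = 0 :=
    fun a a' ha ha' => by rw [hs₂ a ha, hs₂ a' ha', hM₄]
  have hW₅ : ∀ p q : A ⊕ C, (∀ a, p = inl a → a ∈ S) → (∀ a, q = inl a → a ∈ S) →
      M (e.symm (inr p)) (e.symm (inr q)) = X p q :=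
    fun p q hp hq => by rw [hs₃ p hp, hs₃ q hq, hM₅]
  rw [← sum_invol_cut e M,
    Finset.sum_filter (fun f : U ⊕ (A ⊕ C) → U ⊕ (A ⊕ C) =>
      ∀ v, (e.symm (f v)).isLeft = (e.symm v).isLeft),
    Finset.sum_filter (fun f : U ⊕ (A ⊕ C) → U ⊕ (A ⊕ C) =>
      (univ.filter fun a => (f (inr (inl a))).isRight) = S)]
  refine Finset.sum_congr rfl fun f hf => ?_
  simp only [Finset.mem_filter, Finset.mem_univ, true_and] at hf
  by_cases h1 : (univ.filter fun a => (f (inr (inl a))).isRight) = S <;>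
    by_cases h2 : ∀ v, (e.symm (f v)).isLeft = (e.symm v).isLeft
  · rw [if_pos h1, if_pos h2]
    have hS : ∀ a, a ∈ S ↔ ∃ p, f (inr (inl a)) = inr p := fun a => by
      rw [← h1]; simp only [Finset.mem_filter, Finset.mem_univ, true_and, Sum.isRight_iff]
    by_cases hgood : ∀ c, ∃ p, f (inr (inr c)) = inr p
    · exact Fintype.prod_congr _ _ fun v => (stab_and_weight Wuu Wua Wau X S
        (fun v => (e.symm v).isLeft) (fun v w => M (e.symm v) (e.symm w))
        hι₁ hι₂ hι₃ hι₄ hW₁ hW₂ hW₃ hW₅ f hf hS hgood v).2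
    · exfalso
      obtain ⟨c, hc⟩ := not_forall.mp hgood
      exact (bad_case Wuu Wua Wau X (fun v => (e.symm v).isLeft) hι₁ hι₄ f c
        (not_exists.mp hc)).2 h2
  · rw [if_pos h1, if_neg h2]
    have hS : ∀ a, a ∈ S ↔ ∃ p, f (inr (inl a)) = inr p := fun a => by
      rw [← h1]; simp only [Finset.mem_filter, Finset.mem_univ, true_and, Sum.isRight_iff]
    by_cases hgood : ∀ c, ∃ p, f (inr (inr c)) = inr p
    · exact absurd (fun v => (stab_and_weight Wuu Wua Wau X S
        (fun v => (e.symm v).isLeft) (fun v w => M (e.symm v) (e.symm w))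
        hι₁ hι₂ hι₃ hι₄ hW₁ hW₂ hW₃ hW₅ f hf hS hgood v).1) h2
    · obtain ⟨c, hc⟩ := not_forall.mp hgood
      exact (bad_case Wuu Wua Wau X (fun v => (e.symm v).isLeft) hι₁ hι₄ f c
        (not_exists.mp hc)).1
  · rw [if_neg h1, if_pos h2]
    refine (offFibre_case S (fun v => (e.symm v).isLeft) (fun v w => M (e.symm v) (e.symm w))
      hι₁ hι₂ hι₃ hι₄ hW₄ f h2 fun hS => h1 ?_).symm
    ext a
    simp only [Finset.mem_filter, Finset.mem_univ, true_and, Sum.isRight_iff]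
    exact (hS a).symm
  · rw [if_neg h1, if_neg h2]

/-- CUT AT THE ATTACHMENTS: `ihaf (glue Wuu Wua Wau X) = ∑_S Outer S * gsig X S`, where
`Outer S` — the matching sum of the ambient weights on `U ⊕ (A ∖ S)` with all `(A∖S)–(A∖S)` weights
zero — is independent of the gadget `X` and of its private vertex type `C`. [cite: Propp2003, §2] -/
theorem ihaf_glue_eq_sum (Wuu : U → U → R) (Wua : U → A → R) (Wau : A → U → R)
    (X : A ⊕ C → A ⊕ C → R) :
    ihaf (glue Wuu Wua Wau X) = ∑ S : Finset A,
      ihaf (fun x y : U ⊕ {a : A // a ∉ S} =>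
        Sum.elim (fun u => Sum.elim (fun u' => Wuu u u') (fun a' => Wua u a'.1) y)
          (fun a => Sum.elim (fun u' => Wau a.1 u') (fun _ => 0) y) x) * gsig X S := by
  unfold ihaf
  rw [← Finset.sum_fiberwise _ (fun f => univ.filter fun a => (f (inr (inl a))).isRight)]
  refine Finset.sum_congr rfl fun S _ => ?_
  obtain ⟨e, he₁, he₂, he₃⟩ := exists_cutEquiv (U := U) (C := C) S
  exact fibre_sum_of_block Wuu Wua Wau X S e he₁ he₂ he₃
    (fun x y => Sum.elim
      (fun p => Sum.elim
        (fun p' => Sum.elim (fun u => Sum.elim (fun u' => Wuu u u') (fun a' => Wua u a'.1) p')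
          (fun a => Sum.elim (fun u' => Wau a.1 u') (fun _ => 0) p') p)
        (fun _ => 0) y)
      (fun q => Sum.elim (fun _ => 0) (fun q' => X q.1 q'.1) y) x)
    (fun _ _ => rfl) (fun _ _ => rfl) (fun _ _ => rfl) (fun _ _ => rfl) (fun _ _ => rfl)

end Gadget

open Gadget in
/-- **Registered stub `stub_gadgetReplacement`** (crux stmt-ValiantsHypothesis-5067, line `diagonal-spider-shuffling`).
GADGET REPLACEMENT: if two gadgets `X`, `Y` on the same attachments `A` have proportional boundary
signatures, `gsig X S = Λ * gsig Y S` for all `S ⊆ A`, then for every ambient graph glued through the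
attachments the matching sums are proportional with the same factor:
`ihaf (glue Wuu Wua Wau X) = Λ * ihaf (glue Wuu Wua Wau Y)`.  Proof: cut at the attachments
(`Gadget.ihaf_glue_eq_sum`: `ihaf (glue … X) = ∑_S Outer S * gsig X S` with `Outer` gadget-independent)
and linearity; valid over any commutative semiring (Propp 2003 §2 urban renewal; Kuo 2004 Thm 2.1,
graphical condensation, sign-free form). [cite: Propp2003, §2] -/
theorem stub_gadgetReplacement :
    ∀ (R : Type) [CommSemiring R] (U A C₁ C₂ : Type) [Fintype U] [DecidableEq U] [Fintype A] [DecidableEq A]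
      [Fintype C₁] [DecidableEq C₁] [Fintype C₂] [DecidableEq C₂]
      (Wuu : U → U → R) (Wua : U → A → R) (Wau : A → U → R)
      (X : A ⊕ C₁ → A ⊕ C₁ → R) (Y : A ⊕ C₂ → A ⊕ C₂ → R) (Λ : R),
      (∀ S : Finset A, gsig X S = Λ * gsig Y S) →
        ihaf (glue Wuu Wua Wau X) = Λ * ihaf (glue Wuu Wua Wau Y) := by
  intro R _ U A C₁ C₂ _ _ _ _ _ _ _ _ Wuu Wua Wau X Y Λ hXY
  rw [ihaf_glue_eq_sum, ihaf_glue_eq_sum, Finset.mul_sum]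
  refine Finset.sum_congr rfl fun S _ => ?_
  rw [hXY S, mul_left_comm]

end

end Summit.ValiantsHypothesis.ValiantsHypothesis.Theorems.TriangularDimersDivisionEasy.Shuffling
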